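import Literature.Geometry.ComplexHyperbolic.UnitBallU21

/-!
# The Jacobian cocycle of `U(2,1)` on the unit ball `𝔹²`

Continuation of `UnitBallU21.lean` (the projective action `g • z` of `U(2,1)` on `𝔹² ⊂ ℂ²`). For
`w = g · (z, 1)` the map `z ↦ g • z = (w₀/w₂, w₁/w₂)` has Jacobian matrix
`Jac g z = ((g_{ij} w₂ - w_i g_{2j}) / w₂²)_{i,j<2}` (quotient rule). This file proves:

* `det_Jac : det (Jac g z) = det g / w₂³` — the classical determinant of a projective transformation in an
  affine chart (for `Aut 𝔹ⁿ` cf. Rudin's real Jacobian `J_ℝψ = |det ψ'|²`, Thm 2.2.6); `det_Jac_ne_zero`;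
* `coT g z = ((Jac g z)⁻¹)ᵀ` (adjugate formula, `coT_mul_transpose_Jac`), packaged as the continuous linear map
  `A g z` of `ℂ²` — the COTANGENT COCYCLE by which one-forms pull back; `A_injective`, `A_continuous`,
  `continuous_Jac`, `continuous_coT`;
* the CHAIN RULE `Jac_mul : Jac (g h) z = Jac g (h • z) * Jac h z` (an identity of rational functions),
  `Jac_one`, `Jac_inv_mul`, `Jac_mul_inv` — i.e. `Jac` is a `GL₂(ℂ)`-valued cocycle (automorphy factor);
* `hasFDerivAt_actVec` — `Jac g z` IS the Fréchet derivative at `z` of the coordinate expression `actVec g` of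
  the action (so the name is deserved), via `hasFDerivAt_homog` for the affine rows `y ↦ g_{k0}y₀ + g_{k1}y₁ + g_{k2}`.

Sources: the action is that of H. Jacobowitz, *An Introduction to CR Structures* (AMS 1990), Ch. 2 §1
(Theorem 4, pp. 40–41); the cocycle property of the derivative of a group action is the chain rule. All
statements are elementary and PROVED. [folklore]

## Provenance

Staged by the pub-hodgecm formalisation cell (DAG-node prover #03 lineage) under the LEAN-IN-TREE rule; it
supersedes § "Jacobian and cotangent cocycle" of the cell's package file `HodgeCM/PerL34/Ball.lean`, §§ "chain
rule" of `HodgeCM/PerL34/BallCocycle.lean` and the whole of `HodgeCM/PerL34/BallDeriv.lean` (namespace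
`HodgeCM.PerL34.BallModel` ↦ `Literature.Geometry.ComplexHyperbolic.BallModel`, short names unchanged).

## Not here

The isotropy representation at `x₀` and "no stable cotangent line" (`UnitBallIsotropy.lean`); holomorphy as a
map of complex manifolds; the automorphy factor `(det Jac)^{-1/3}`-type roots.
-/

set_option autoImplicit false

noncomputable section

open Matrix Complex ComplexConjugate

namespace Literature.Geometry.ComplexHyperbolic

namespace BallModel

/-! ### The Jacobian of the action and the cotangent cocycle -/

/-- Jacobian matrix of `z ↦ g • z` at `z` in the coordinates `z₀, z₁`: with `w = g·(z,1)`,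
`∂(w_i/w₂)/∂z_j = (g_{ij} w₂ - w_i g_{2j}) / w₂²`. [folklore] -/
def Jac (g : U21) (z : Ball) : Matrix (Fin 2) (Fin 2) ℂ :=
  Matrix.of fun i j => (mat g (Fin.castSucc i) (Fin.castSucc j) * W3 g z 2 -
    W3 g z (Fin.castSucc i) * mat g 2 (Fin.castSucc j)) / W3 g z 2 ^ 2

/-- The classical formula `det D(g)(z) = det g / w₂³` for the Jacobian determinant of a projective
transformation of `ℙ²` in the affine chart `w₂ = 1`. [folklore] -/
theorem det_Jac (g : U21) (z : Ball) : (Jac g z).det = (mat g).det / W3 g z 2 ^ 3 := by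
  have h2 := W3_2_ne_zero g z
  rw [W3_apply] at h2
  simp only [Matrix.det_fin_two, Matrix.det_fin_three, Jac, Matrix.of_apply, W3_apply, Fin.castSucc_zero,
    Fin.castSucc_one]
  field_simp
  ring

/-- The Jacobian is invertible at every point of the ball. [folklore] -/
theorem det_Jac_ne_zero (g : U21) (z : Ball) : (Jac g z).det ≠ 0 := by
  rw [det_Jac]; exact div_ne_zero (det_mat_ne_zero g) (pow_ne_zero _ (W3_2_ne_zero g z))

/-- The cotangent cocycle matrix `((D_z g)⁻¹)ᵀ`, written out by the `2 × 2` adjugate formula. [folklore] -/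
def coT (g : U21) (z : Ball) : Matrix (Fin 2) (Fin 2) ℂ :=
  ((Jac g z).det)⁻¹ • !![Jac g z 1 1, -Jac g z 1 0; -Jac g z 0 1, Jac g z 0 0]

/-- `coT g z` is the inverse transpose of the Jacobian: `coT · Jacᵀ = 1`. [folklore] -/
theorem coT_mul_transpose_Jac (g : U21) (z : Ball) : coT g z * (Jac g z)ᵀ = 1 := by
  have hd := det_Jac_ne_zero g z
  rw [Matrix.det_fin_two] at hd
  ext i j
  fin_cases i <;> fin_cases j <;>
    · simp [coT, Matrix.mul_apply, Fin.sum_univ_two, Matrix.det_fin_two]; field_simp; ring1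

/-- `det coT = (det Jac)⁻¹`. [folklore] -/
theorem det_coT (g : U21) (z : Ball) : (coT g z).det = ((Jac g z).det)⁻¹ := by
  have hd := det_Jac_ne_zero g z
  rw [Matrix.det_fin_two] at hd
  simp only [coT, Matrix.det_smul, Matrix.det_fin_two, Fintype.card_fin]
  simp only [Matrix.of_apply, Matrix.cons_val', Matrix.cons_val_zero, Matrix.cons_val_one, Matrix.empty_val',
    Matrix.cons_val_fin_one]
  field_simp

/-- The cotangent cocycle `A g z = ((D_z g)⁻¹)ᵀ` as a continuous linear map of `ℂ² = T^*_z 𝔹²` (frame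
`dz₀, dz₁`). [folklore] -/
def A (g : U21) (z : Ball) : (Fin 2 → ℂ) →L[ℂ] (Fin 2 → ℂ) :=
  LinearMap.toContinuousLinearMap (Matrix.mulVecLin (coT g z))

/-- `A g z w = coT g z · w`. [folklore] -/
@[simp] theorem A_apply (g : U21) (z : Ball) (w : Fin 2 → ℂ) : A g z w = coT g z *ᵥ w := rfl

/-- The cotangent cocycle is fibrewise injective. [folklore] -/
theorem A_injective (g : U21) (z : Ball) : Function.Injective (A g z) := by
  have hU : IsUnit (coT g z) := by
    rw [Matrix.isUnit_iff_isUnit_det, det_coT, isUnit_iff_ne_zero]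
    exact inv_ne_zero (det_Jac_ne_zero g z)
  intro v w h
  exact Matrix.mulVec_injective_iff_isUnit.2 hU h

/-- `g ↦ Jac g z` is continuous. [folklore] -/
theorem continuous_Jac (z : Ball) : Continuous fun g : U21 => Jac g z := by
  refine continuous_matrix fun i j => ?_
  simp only [Jac, Matrix.of_apply]
  exact (((continuous_mat.matrix_elem _ _).mul (continuous_W3_left z 2)).sub
    ((continuous_W3_left z _).mul (continuous_mat.matrix_elem _ _))).div
    ((continuous_W3_left z 2).pow 2) fun g => pow_ne_zero _ (W3_2_ne_zero g z)

/-- `g ↦ coT g z` is continuous. [folklore] -/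
theorem continuous_coT (z : Ball) : Continuous fun g : U21 => coT g z := by
  have hd : Continuous fun g : U21 => ((Jac g z).det)⁻¹ :=
    ((continuous_Jac z).matrix_det).inv₀ fun g => det_Jac_ne_zero g z
  have hJ := continuous_Jac z
  refine hd.smul (continuous_matrix fun i j => ?_)
  fin_cases i <;> fin_cases j <;>
    simp only [Matrix.of_apply, Matrix.cons_val', Matrix.empty_val', Matrix.cons_val_fin_one]
  · exact hJ.matrix_elem 1 1
  · exact (hJ.matrix_elem 1 0).neg
  · exact (hJ.matrix_elem 0 1).neg
  · exact hJ.matrix_elem 0 0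

/-- The cocycle is continuous in the group variable (at every point and vector). [folklore] -/
theorem A_continuous (z : Ball) (w : Fin 2 → ℂ) : Continuous fun g : U21 => A g z w := by
  simp only [A_apply]
  exact (continuous_coT z).matrix_mulVec continuous_const

/-- The transpose Jacobian is continuous in the group variable. [folklore] -/
theorem continuous_Jac_transpose (z : Ball) : Continuous fun g : U21 => (Jac g z)ᵀ :=
  (continuous_Jac z).matrix_transpose

/-- The transpose Jacobian is invertible. [folklore] -/
theorem isUnit_Jac_transpose (g : U21) (z : Ball) : IsUnit (Jac g z)ᵀ := by
  rw [Matrix.isUnit_iff_isUnit_det, Matrix.det_transpose, isUnit_iff_ne_zero]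
  exact det_Jac_ne_zero g z

/-! ### Chain rule: `Jac` is a cocycle -/

/-- `(gh)·(z,1) = g·(h·(z,1))`. [folklore] -/
theorem W3_mul (g h : U21) (z : Ball) : W3 (g * h) z = mat g *ᵥ W3 h z := by
  unfold W3; rw [mat_mul, ← Matrix.mulVec_mulVec]

/-- `g·(h • z, 1) = (h·(z,1))₂⁻¹ · g·(h·(z,1))`. [folklore] -/
theorem W3_smul (g h : U21) (z : Ball) (k : Fin 3) :
    W3 g (h • z) k = (W3 h z 2)⁻¹ * (mat g *ᵥ W3 h z) k := by
  rw [smul_def]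
  unfold W3
  rw [lift_act, Matrix.mulVec_smul]
  rfl

/-- **Chain rule** for the Jacobian matrices of the action: `Jac (gh) z = Jac g (h • z) · Jac h z`. [folklore] -/
theorem Jac_mul (g h : U21) (z : Ball) : Jac (g * h) z = Jac g (h • z) * Jac h z := by
  have hc : W3 h z 2 ≠ 0 := W3_2_ne_zero h z
  have hd : W3 (g * h) z 2 ≠ 0 := W3_2_ne_zero (g * h) z
  rw [W3_mul] at hd
  ext i k
  simp only [Jac, Matrix.mul_apply, Matrix.of_apply, Fin.sum_univ_two, W3_smul, W3_mul, mat_mul,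
    Fin.sum_univ_three, Matrix.mulVec, dotProduct, Fin.castSucc_zero, Fin.castSucc_one, Fin.isValue] at hd ⊢
  field_simp
  ring

/-- `1·(z,1) = (z,1)`. [folklore] -/
theorem W3_one (z : Ball) : W3 1 z = lift z := by
  unfold W3; rw [mat_one, Matrix.one_mulVec]

/-- `Jac 1 z = 1`. [folklore] -/
theorem Jac_one (z : Ball) : Jac 1 z = 1 := by
  ext i j
  fin_cases i <;> fin_cases j <;> simp [Jac, W3_one, Matrix.one_apply]

/-- `Jac g⁻¹ (g • z) · Jac g z = 1`. [folklore] -/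
theorem Jac_inv_mul (g : U21) (z : Ball) : Jac g⁻¹ (g • z) * Jac g z = 1 := by
  rw [← Jac_mul, inv_mul_cancel, Jac_one]

/-- `Jac g z · Jac g⁻¹ (g • z) = 1`. [folklore] -/
theorem Jac_mul_inv (g : U21) (z : Ball) : Jac g z * Jac g⁻¹ (g • z) = 1 :=
  mul_eq_one_comm.1 (Jac_inv_mul g z)

/-! ### `Jac g z` is the derivative of `z ↦ g • z` -/

/-- The action of `g` in the coordinates `(z₀, z₁)`, by the same fractional-linear formula on all of `ℂ²`
(meaningful where the third homogeneous coordinate `w₂` is nonzero, in particular on the ball).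
[cite: Jacobowitz1990, Ch. 2 §1 (p. 40)] -/
def actVec (g : U21) (y : Fin 2 → ℂ) : Fin 2 → ℂ :=
  fun i => (mat g *ᵥ ![y 0, y 1, 1]) (Fin.castSucc i) / (mat g *ᵥ ![y 0, y 1, 1]) 2

/-- `lift z = (z₀, z₁, 1)`. [folklore] -/
theorem lift_eq (z : Ball) : lift z = ![z.1 0, z.1 1, 1] := rfl

/-- `actVec g` agrees with the action on the ball. [folklore] -/
theorem actVec_eq (g : U21) (z : Ball) : actVec g z.1 = (g • z).1 := by
  funext i
  rw [smul_val, actVec]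
  rfl

/-- The linear part `y ↦ g_{k0} y₀ + g_{k1} y₁` of the `k`-th homogeneous coordinate of `g·(y,1)`. [folklore] -/
def rowCLM (g : U21) (k : Fin 3) : (Fin 2 → ℂ) →L[ℂ] ℂ :=
  mat g k 0 • ContinuousLinearMap.proj 0 + mat g k 1 • ContinuousLinearMap.proj 1

/-- `rowCLM g k y = g_{k0} y₀ + g_{k1} y₁`. [folklore] -/
@[simp] theorem rowCLM_apply (g : U21) (k : Fin 3) (y : Fin 2 → ℂ) :
    rowCLM g k y = mat g k 0 * y 0 + mat g k 1 * y 1 := by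
  simp [rowCLM]

/-- `(g·(y,1))ₖ = rowCLM g k y + g_{k2}`. [folklore] -/
theorem homog_eq (g : U21) (k : Fin 3) (y : Fin 2 → ℂ) :
    (mat g *ᵥ ![y 0, y 1, 1]) k = rowCLM g k y + mat g k 2 := by
  simp [Matrix.mulVec, dotProduct, Fin.sum_univ_three]

/-- The affine row `y ↦ (g·(y,1))ₖ` has derivative `rowCLM g k`. [folklore] -/
theorem hasFDerivAt_homog (g : U21) (k : Fin 3) (y₀ : Fin 2 → ℂ) :
    HasFDerivAt (fun y : Fin 2 → ℂ => (mat g *ᵥ ![y 0, y 1, 1]) k) (rowCLM g k) y₀ := by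
  have : (fun y : Fin 2 → ℂ => (mat g *ᵥ ![y 0, y 1, 1]) k) = fun y => rowCLM g k y + mat g k 2 :=
    funext (homog_eq g k)
  rw [this]
  exact (rowCLM g k).hasFDerivAt.add_const _

/-- **`Jac g z` is the Jacobian:** the coordinate action map `actVec g` has Fréchet derivative
`y ↦ Jac g z · y` at every point `z` of the ball. [folklore] -/
theorem hasFDerivAt_actVec (g : U21) (z : Ball) :
    HasFDerivAt (actVec g) (LinearMap.toContinuousLinearMap (Matrix.mulVecLin (Jac g z))) z.1 := by
  have hD0 : (mat g *ᵥ ![z.1 0, z.1 1, 1]) 2 ≠ 0 := W3_2_ne_zero g z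
  have hinv : HasFDerivAt (fun y : Fin 2 → ℂ => ((mat g *ᵥ ![y 0, y 1, 1]) 2)⁻¹)
      ((ContinuousLinearMap.toSpanSingleton ℂ (-((mat g *ᵥ ![z.1 0, z.1 1, 1]) 2 ^ 2)⁻¹)).comp (rowCLM g 2))
      z.1 :=
    (hasFDerivAt_inv hD0).comp z.1 (hasFDerivAt_homog g 2 z.1)
  rw [hasFDerivAt_pi']
  intro i
  have hfun : (fun y => actVec g y i) =
      fun y => (mat g *ᵥ ![y 0, y 1, 1]) (Fin.castSucc i) * ((mat g *ᵥ ![y 0, y 1, 1]) 2)⁻¹ := by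
    funext y; rw [actVec, div_eq_mul_inv]
  rw [hfun]
  refine ((hasFDerivAt_homog g (Fin.castSucc i) z.1).fun_mul hinv).congr_fderiv ?_
  ext y
  have hW : ∀ k, (mat g *ᵥ ![z.1 0, z.1 1, 1]) k = W3 g z k := fun k => rfl
  simp only [hW] at hD0 ⊢
  fin_cases i <;> (simp [Jac]; field_simp; ring)

end BallModel

end Literature.Geometry.ComplexHyperbolic

end
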